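import Mathlib.Analysis.Complex.Schwarz

/-!
# T⁴ programme, spine estimate NE1′ (node O3b/H2) — THE SMALL-FIELD HALF OF THE PAY∕ALLOWANCE ARITHMETIC (leaf L-P): the
# μ-augmented smallness in the (2.41)-type clause, the THIRD Cauchy radius (in the source ∕ in a family's content strength)
# DISPLAYED, and the regeneration constant of the re-born μ-parts by the Schwarz lemma (R8 «linear response» without termwise
# differentiation of the activity series)

Cell `pub-balaban`, sub-cell `t4`, BINDER-OWNERS row NE1′; owner lineage t4-ne1p-p1 (PROVER seat P1, «RG-trajectory comparison»),
generation 25; companion of the owner memo `HOME/b2b-balaban-t4-ne1p-p1/g25/OWNER-ANSWERS-g25.md` §3 (answers to t4-ref2 pass 72,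
GAPS-T4 C-t4r2-340 notes (n1)–(n5)).  ADDITIVE — imports Mathlib only; THEOREMS ONLY (no `def`, no `def … : Prop`).  Sibling of
`Spine/NE1p/DressedSigmaRoute.lean` (p217353: the met-component half, [Balaban1989LargeFieldII] p. 389's clause).

WHY THIS FILE.  Under the representation of record F-2-ROUTE-FULL (T4-DAG v28 §8 Q40) the observable-attached terms of scale `k+1`
at a SMALL-FIELD step are the μ-parts of print's localized outputs `E^{(k+1)}(X)` of the exponentiated polymer expansion
[Balaban1988RGII] (2.11)–(2.13) p. 14, whose activities obey Lemma 3 (2.38) p. 20 «|H(Z)| ≤ C₃ε₁ exp(−(1−8δ)½Lκd_{k+1}(Z))» under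
«all the above restrictions on the constants M, κ, κ₁, α₀, α₁, α₄, α₆, γ₂, γ, ε₁», and whose sum obeys (2.41) p. 21
«|E^{(k+1)}(X)| ≤ O(1)C₃ε₁ exp(−(1−10δ)½Lκd_{k+1}(X))» with the closing clause «O(1)C₃ε₁ ≤ ½E₀» — LOCI (renders p014, p020, p021
read as images by t4-ref2 pass 72, C-t4r2-339: CONFIRMED 3/3), TYPE/CONTEXT only; these pages contain NO observable and NO μ
(C-t4r2-340 (n1)): the μ-extension below is the cell's, UNPRINTED, and every clause here is ARITHMETIC OVER SHAPES with the
printed constants as real BINDERS (n4), never numerals taken from print.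

* §1 LINEAR RESPONSE BY THE SCHWARZ LEMMA [folklore complex analysis, Mathlib `Complex.dist_le_div_mul_dist_of_mapsTo_ball` ∕
  `Complex.norm_deriv_le_div_of_mapsTo_ball` BY NAME]: a vector-valued function analytic on a disc of radius `R` about `c` and bounded
  by `M` there moves by at most `(2M/R)·‖z − c‖`, and its derivative at the centre is at most `2M/R` — the «third Cauchy radius»
  (n2) is the `R` in these denominators, DISPLAYED.
* §2 THE SOURCE WINDOW AS A STRICT SUB-WINDOW (n2): for a dressed quantity `E(μ)` analytic on `|μ| < μ₁` and bounded by `M` there,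
  the observable-attached part obeys `‖E(μ) − E(0)‖ ≤ (2M/μ₁)·|μ|` on the whole disc (`muPart_norm_le`), `≤ 2M·μ₀/μ₁` on a window
  `|μ| ≤ μ₀ < μ₁` (`muPart_norm_le_of_window`), and the linear response `‖E′(μ)‖ ≤ 2M/(μ₁ − μ₀)` there (`muDeriv_norm_le_of_window`):
  the (w6) window MUST be a strict sub-window of the μ-analyticity disc and the quotient enters the constant — typed as binders.
* §3 THE REGENERATION CONSTANT FROM THE SLACK (R8's size law of the re-born μ-parts at small-field steps, (w5)): if the content
  of family `b` enters the step's output with a strength parameter `s` (actual value `s = 1`), the output is analytic in `s` on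
  `|s| < ε/σ` and bounded by `M` there — `σ` the family's booked size at the step, `ε` the slack print's clause leaves for extra
  potential (the μ-augmented smallness stays admissible while `|s|·σ < ε`) — then for `σ < ε` the `b`-sourced part of the output is
  `≤ (2M/ε)·σ` (`regen_le_of_slack`): the regeneration constant `c̄ = 2M/ε` DISPLAYED, no termwise differentiation of the series.
* §4 THE (2.41)-TYPE CLAUSE WITH μ-AUGMENTED SMALLNESS (n4): `O₁·C₃·ε ≤ E₀/2` with `ε := ε₁ + μ₁·b (+ σ)` — monotone
  (`sfClause_mono`), the slack `E₀/(2O₁C₃) − ε₁ − μ₁b` (`sfClause_of_le_slack`), and the admissible μ-RADIUS it leaves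
  (`muRadius_le_of_sfClause`: `μ₁ ≤ (E₀/(2O₁C₃) − ε₁)/b`) — the (w6) window from print's clause SHAPE; (n5): the normaliser
  `log Z^{(k)}` of p. 21 is μ-FREE (Gaussian, main quadratic form) and cancels in `E(μ) − E(0)` — nothing of it enters the dressed part
  (its «M sufficiently large, δ₀M ≥ κ» stays print's own clause for the undressed part; recorded, not typed).
* §5 (w7) ON THIS ROUTE [arith]: with the same-lattice transport constant `4c_δ` (sibling `DressedRootSameLattice`) and `c̄ = 2M/ε`
  the located largeness at continuation factor one is `1/L + 8·L·c_δ·M/ε`; `2 ≤ L` and `32·L·c_δ·M ≤ ε` give `≤ 3/4 < 1`.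

HONEST FRAMING.  §1–§2 are textbook complex analysis (kernel, by Mathlib); §3–§5 are arithmetic over SHAPES.  Whether Bałaban's
dressed small-field outputs are analytic in μ ∕ in a family's content strength on the displayed discs with the displayed bounds is
the cell's UNPRINTED extension of (2.14)–(2.15)∕(2.38)–(2.41) (C-t4r2-340 (n1), (n3): convergence «by [26]» is a citation-class step
for the UNEXTENDED activities only) — a BINDER wherever it is used, asserted for NOTHING here.  NE1′ ⇐ the named binders, NOT proved;
0 leaves instantiated on Bałaban's densities; spine PROVED 0∕9.  Rung (B)+1 on ONE finite four-torus — NOT infinite volume, NOT a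
mass gap, NOT OS on ℝ⁴, NOT Clay.  HONEST DEPENDENCY: continuum YM on T⁴ ⇐ BetaPertH ∧ nine spine estimates (0/9 proved); BetaPertH ⇐
(D1) ∧ (D4) ∧ CAP+tail; G-an2-4 gates asym, D1 and NE2/3/4.
-/

noncomputable section

namespace Summit.QuantumFields.BalabanUV.T4Continuum.NE1p.DressedSmallFieldAllowance

open Metric Set Complex

/-! ## §1 Linear response by the Schwarz lemma -/

section Schwarz

variable {F : Type*} [NormedAddCommGroup F] [NormedSpace ℂ F] {f : ℂ → F} {c z : ℂ} {R M : ℝ}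

omit [NormedSpace ℂ F] in
/-- A function bounded by `M` on an open disc sends the disc into the closed ball of radius `2M` about its value at the centre.
[folklore] -/
theorem mapsTo_closedBall_of_bound (hR : 0 < R) (hM : ∀ z ∈ ball c R, ‖f z‖ ≤ M) :
    MapsTo f (ball c R) (closedBall (f c) (2 * M)) := by
  intro z hz
  rw [mem_closedBall, dist_eq_norm]
  have h1 := hM z hz
  have h2 := hM c (mem_ball_self hR)
  calc ‖f z - f c‖ ≤ ‖f z‖ + ‖f c‖ := norm_sub_le _ _
    _ ≤ M + M := add_le_add h1 h2
    _ = 2 * M := by ring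

/-- **LINEAR RESPONSE, SIZE FORM** [folklore — Schwarz lemma]: analytic on the disc of radius `R` about `c`, bounded by `M` there
⇒ `‖f z − f c‖ ≤ (2M/R)·‖z − c‖` on the disc.  `R` is the DISPLAYED Cauchy radius. -/
theorem norm_sub_le_of_ball (hd : DifferentiableOn ℂ f (ball c R)) (hM : ∀ z ∈ ball c R, ‖f z‖ ≤ M)
    (hz : z ∈ ball c R) : ‖f z - f c‖ ≤ 2 * M / R * ‖z - c‖ := by
  have hR : 0 < R := lt_of_le_of_lt dist_nonneg (mem_ball.1 hz)
  have h := dist_le_div_mul_dist_of_mapsTo_ball hd (mapsTo_closedBall_of_bound hR hM) hz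
  simpa [dist_eq_norm] using h

/-- **LINEAR RESPONSE, DERIVATIVE FORM** [folklore — Schwarz∕Cauchy]: analytic on the disc of radius `R > 0` about `c`, bounded by
`M` there ⇒ `‖f′(c)‖ ≤ 2M/R`. -/
theorem norm_deriv_le_of_ball (hd : DifferentiableOn ℂ f (ball c R)) (hM : ∀ z ∈ ball c R, ‖f z‖ ≤ M)
    (hR : 0 < R) : ‖deriv f c‖ ≤ 2 * M / R :=
  norm_deriv_le_div_of_mapsTo_ball hd (mapsTo_closedBall_of_bound hR hM) hR

end Schwarz

/-! ## §2 The source window as a strict sub-window of the μ-analyticity disc (C-t4r2-340 (n2)) -/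

section MuWindow

variable {F : Type*} [NormedAddCommGroup F] [NormedSpace ℂ F] {E : ℂ → F} {μ₁ μ₀ M : ℝ} {μ : ℂ}

/-- **THE OBSERVABLE-ATTACHED PART ON THE WHOLE DISC** [folklore]: `E` analytic on `|μ| < μ₁`, `‖E‖ ≤ M` there ⇒
`‖E(μ) − E(0)‖ ≤ (2M/μ₁)·|μ|` for `|μ| < μ₁`. -/
theorem muPart_norm_le (hd : DifferentiableOn ℂ E (ball 0 μ₁)) (hM : ∀ μ ∈ ball 0 μ₁, ‖E μ‖ ≤ M)
    (hμ : ‖μ‖ < μ₁) : ‖E μ - E 0‖ ≤ 2 * M / μ₁ * ‖μ‖ := by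
  have hz : μ ∈ ball (0 : ℂ) μ₁ := by rwa [mem_ball, dist_zero_right]
  simpa using norm_sub_le_of_ball hd hM hz

/-- **… ON A STRICT SUB-WINDOW** [folklore]: for `|μ| ≤ μ₀ < μ₁` (and `M ≥ 0`) the observable-attached part is `≤ 2M·μ₀/μ₁` — the
(w6) window `μ₀` against the DISPLAYED analyticity radius `μ₁`. -/
theorem muPart_norm_le_of_window (hd : DifferentiableOn ℂ E (ball 0 μ₁)) (hM : ∀ μ ∈ ball 0 μ₁, ‖E μ‖ ≤ M)
    (hM0 : 0 ≤ M) (h01 : μ₀ < μ₁) (hμ : ‖μ‖ ≤ μ₀) : ‖E μ - E 0‖ ≤ 2 * M * μ₀ / μ₁ := by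
  have hμ1 : ‖μ‖ < μ₁ := lt_of_le_of_lt hμ h01
  have hμ₁ : 0 < μ₁ := lt_of_le_of_lt (norm_nonneg μ) hμ1
  calc ‖E μ - E 0‖ ≤ 2 * M / μ₁ * ‖μ‖ := muPart_norm_le hd hM hμ1
    _ ≤ 2 * M / μ₁ * μ₀ := mul_le_mul_of_nonneg_left hμ (by positivity)
    _ = 2 * M * μ₀ / μ₁ := by ring

/-- **LINEAR RESPONSE IN μ ON THE SUB-WINDOW** [folklore — Cauchy estimate off centre]: for `|μ| ≤ μ₀ < μ₁` the disc of radius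
`μ₁ − μ₀` about `μ` lies in the analyticity disc, so `‖E′(μ)‖ ≤ 2M/(μ₁ − μ₀)` — the quotient `1/(μ₁ − μ₀)` is what enters the
constants when the series is differentiated in μ ((n2)'s «third Cauchy radius»). -/
theorem muDeriv_norm_le_of_window (hd : DifferentiableOn ℂ E (ball 0 μ₁)) (hM : ∀ μ ∈ ball 0 μ₁, ‖E μ‖ ≤ M)
    (h01 : μ₀ < μ₁) (hμ : ‖μ‖ ≤ μ₀) : ‖deriv E μ‖ ≤ 2 * M / (μ₁ - μ₀) := by
  have hsub : ball μ (μ₁ - μ₀) ⊆ ball 0 μ₁ := by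
    intro z hz
    rw [mem_ball, dist_zero_right]
    rw [mem_ball, dist_eq_norm] at hz
    calc ‖z‖ = ‖(z - μ) + μ‖ := by rw [sub_add_cancel]
      _ ≤ ‖z - μ‖ + ‖μ‖ := norm_add_le _ _
      _ < (μ₁ - μ₀) + μ₀ := add_lt_add_of_lt_of_le hz hμ
      _ = μ₁ := by ring
  exact norm_deriv_le_of_ball (hd.mono hsub) (fun z hz => hM z (hsub hz)) (by linarith)

end MuWindow

/-! ## §3 The regeneration constant from the slack of the clause (R8 at small-field steps, (w5)) -/

section Regeneration

variable {F : Type*} [NormedAddCommGroup F] [NormedSpace ℂ F] {E : ℂ → F} {ε σ M : ℝ}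

/-- **THE RE-BORN μ-PART SOURCED BY ONE FAMILY IS LINEAR IN ITS BOOKED SIZE** [folklore — Schwarz in the content strength]: the
step's output as a function `E(s)` of the strength `s` with which the family's content (booked size `σ > 0` at the step) enters —
actual value `s = 1`, `s = 0` = the output without the family — analytic on `|s| < ε/σ` (the disc on which the μ-augmented
smallness stays within the clause: extra potential `|s|·σ < ε`, `ε` the slack) and bounded by `M` there; if `σ < ε` then
`‖E(1) − E(0)‖ ≤ (2M/ε)·σ`.  So the regeneration constant is `c̄ = 2M/ε`: output bound over slack, K-free iff both are. -/
theorem regen_le_of_slack (hσ : 0 < σ) (hσε : σ < ε) (hd : DifferentiableOn ℂ E (ball 0 (ε / σ)))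
    (hM : ∀ s ∈ ball (0 : ℂ) (ε / σ), ‖E s‖ ≤ M) : ‖E 1 - E 0‖ ≤ 2 * M / ε * σ := by
  have hε : 0 < ε := hσ.trans hσε
  have h1 : (1 : ℂ) ∈ ball (0 : ℂ) (ε / σ) := by
    rw [mem_ball, dist_zero_right, norm_one, lt_div_iff₀ hσ, one_mul]
    exact hσε
  have h := norm_sub_le_of_ball hd hM h1
  rw [sub_zero, norm_one, mul_one] at h
  calc ‖E 1 - E 0‖ ≤ 2 * M / (ε / σ) := h
    _ = 2 * M / ε * σ := by field_simp

/-- The same with an a-priori bound `σ ≤ σ̄ < ε` on the booked size (the class bound at the step): `‖E(1) − E(0)‖ ≤ (2M/ε)·σ̄`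
for `M ≥ 0`. [arith] -/
theorem regen_le_of_slack_of_le (hσ : 0 < σ) {σbar : ℝ} (hσσ : σ ≤ σbar) (hσε : σbar < ε) (hM0 : 0 ≤ M)
    (hd : DifferentiableOn ℂ E (ball 0 (ε / σ))) (hM : ∀ s ∈ ball (0 : ℂ) (ε / σ), ‖E s‖ ≤ M) :
    ‖E 1 - E 0‖ ≤ 2 * M / ε * σbar := by
  have hε : 0 < ε := lt_of_le_of_lt (hσ.le.trans hσσ) hσε
  exact (regen_le_of_slack hσ (lt_of_le_of_lt hσσ hσε) hd hM).trans
    (mul_le_mul_of_nonneg_left hσσ (by positivity))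

end Regeneration

/-! ## §4 The (2.41)-type clause with μ-augmented smallness (C-t4r2-340 (n4)) -/

section Clause

/-- **MONOTONE IN THE SMALLNESS** [arith]: the clause `O₁·C₃·ε ≤ E₀/2` (print's «O(1)C₃ε₁ ≤ ½E₀», SHAPE) is inherited by any
smaller `ε′ ≤ ε` when `O₁·C₃ ≥ 0`. -/
theorem sfClause_mono {O₁ C₃ E₀ ε ε' : ℝ} (hOC : 0 ≤ O₁ * C₃) (hε : ε' ≤ ε) (h : O₁ * C₃ * ε ≤ E₀ / 2) :
    O₁ * C₃ * ε' ≤ E₀ / 2 :=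
  (mul_le_mul_of_nonneg_left hε hOC).trans h

/-- **THE μ-AUGMENTED CLAUSE FROM THE SLACK** [arith]: with `ε := ε₁ + μ₁·b + σ` (undressed potential smallness `ε₁`, observable
density `b` at source radius `μ₁`, one family's content `σ`), the clause holds as soon as `σ` is within the slack
`E₀/(2·O₁·C₃) − ε₁ − μ₁·b` (`O₁·C₃ > 0`). -/
theorem sfClause_of_le_slack {O₁ C₃ E₀ ε₁ μ₁ b σ : ℝ} (hOC : 0 < O₁ * C₃)
    (hσ : σ ≤ E₀ / (2 * (O₁ * C₃)) - ε₁ - μ₁ * b) :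
    O₁ * C₃ * (ε₁ + μ₁ * b + σ) ≤ E₀ / 2 := by
  have h1 : ε₁ + μ₁ * b + σ ≤ E₀ / (2 * (O₁ * C₃)) := by linarith
  have hO : O₁ ≠ 0 := by rintro rfl; simp at hOC
  have hC : C₃ ≠ 0 := by rintro rfl; simp at hOC
  calc O₁ * C₃ * (ε₁ + μ₁ * b + σ) ≤ O₁ * C₃ * (E₀ / (2 * (O₁ * C₃))) := mul_le_mul_of_nonneg_left h1 hOC.le
    _ = E₀ / 2 := by field_simp

/-- **THE ADMISSIBLE SOURCE RADIUS FROM THE CLAUSE** [arith]: if the μ-augmented clause `O₁·C₃·(ε₁ + μ₁·b) ≤ E₀/2` is to hold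
with a positive observable density `b`, then `μ₁ ≤ (E₀/(2·O₁·C₃) − ε₁)/b` — the (w6)-type window read off print's clause SHAPE. -/
theorem muRadius_le_of_sfClause {O₁ C₃ E₀ ε₁ μ₁ b : ℝ} (hOC : 0 < O₁ * C₃) (hb : 0 < b)
    (h : O₁ * C₃ * (ε₁ + μ₁ * b) ≤ E₀ / 2) : μ₁ ≤ (E₀ / (2 * (O₁ * C₃)) - ε₁) / b := by
  rw [le_div_iff₀ hb]
  have h2 : ε₁ + μ₁ * b ≤ E₀ / (2 * (O₁ * C₃)) := by
    rw [le_div_iff₀ (by positivity)]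
    linarith
  linarith

/-- Conversely a source radius inside that bound (with `ε₁ ≤ E₀/(2O₁C₃)`) satisfies the μ-augmented clause. [arith] -/
theorem sfClause_of_muRadius_le {O₁ C₃ E₀ ε₁ μ₁ b : ℝ} (hOC : 0 < O₁ * C₃) (hb : 0 < b)
    (h : μ₁ ≤ (E₀ / (2 * (O₁ * C₃)) - ε₁) / b) : O₁ * C₃ * (ε₁ + μ₁ * b) ≤ E₀ / 2 := by
  have h1 : μ₁ * b ≤ E₀ / (2 * (O₁ * C₃)) - ε₁ := (le_div_iff₀ hb).1 h
  have h2 := sfClause_of_le_slack (σ := 0) (μ₁ := μ₁) (b := b) (ε₁ := ε₁) (E₀ := E₀) hOC (by linarith)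
  simpa using h2

end Clause

/-! ## §5 (w7) on this route -/

section Product

/-- **THE LOCATED LARGENESS WITH THE SCHWARZ REGENERATION CONSTANT** [arith]: transport constant `4c_δ` (same-lattice face),
regeneration constant `2M/ε`, continuation factor one: `1/L + L·(4c_δ)·(2M/ε) = 1/L + 8·L·c_δ·M/ε`. -/
theorem locatedLargeness_eq (L cδ M ε : ℝ) :
    1 / L + L * (4 * cδ) * (2 * M / ε) = 1 / L + 8 * L * cδ * M / ε := by
  ring

/-- **… AND A SUFFICIENT SMALLNESS** [arith]: `2 ≤ L`, `ε > 0`, and `32·L·c_δ·M ≤ ε` give `1/L + 8·L·c_δ·M/ε ≤ 3/4 < 1` — (w7)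
holds when (normalised defect constant) × (output bound) is small against the clause's slack; decided arithmetic of the cell's
shapes, NOT a statement about Bałaban's constants. -/
theorem locatedLargeness_le_of_small {L cδ M ε : ℝ} (hL : 2 ≤ L) (hε : 0 < ε) (hsmall : 32 * L * cδ * M ≤ ε) :
    1 / L + 8 * L * cδ * M / ε ≤ 3 / 4 := by
  have hL0 : 0 < L := by linarith
  have h1 : 1 / L ≤ 1 / 2 := by
    rw [div_le_div_iff₀ hL0 (by norm_num : (0:ℝ) < 2)]; linarith
  have h2 : 8 * L * cδ * M / ε ≤ 1 / 4 := by
    rw [div_le_div_iff₀ hε (by norm_num : (0:ℝ) < 4)]; linarith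
  linarith

end Product

end Summit.QuantumFields.BalabanUV.T4Continuum.NE1p.DressedSmallFieldAllowance

end
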